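import Literature.Barriers.CriticalPhenomena.WeaklySAWSiteProcess
import Literature.Barriers.CriticalPhenomena.WeaklySAWGrandCanonical
import HarnessLib

/-!
# The bridge: the grand-canonical susceptibility as an expectation over the i.i.d. site process

Companion to `WeaklySAWGrandCanonical.lean` (`susceptibility_eq_tsum_stepSeq`:
`χ(g,ν) = Σ_k Σ_{e : StepSeq d k} gcTerm g (2d+ν) k (pos e)`) and `WeaklySAWSiteProcess.lean`
(`configLaw d λ`: i.i.d. sites `unif(Dir d) ⊗ Exp(λ)`). Normalising the free sojourn weight
`e^{-λ Σ σ}` by `λ^{k+1}` and the uniform counting over `k`-step skeletons by `(2d)^k` exhibits the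
`k`-th term as an expectation:

* `Qcfg k ω` — the self-intersection functional `Σ_{i,j ≤ k} σᵢ σⱼ 𝟙{Sᵢ = Sⱼ}` of the first
  `k + 1` sites of a configuration (`freeSelfInt` of `WeaklySAWGrandCanonical.lean` read on the
  configuration); measurable, and it depends only on the sites `< k + 1`;
* `lintegral_pi_sojLaw` — integrating against `Exp(λ)^{⊗ m}` is integrating against
  `λ^m e^{-λ Σ σ} dσ` on `(0,∞)^m`;
* **`lintegral_exp_Qcfg_eq`** / **`sum_gcTerm_eq`** —
  `Σ_{e : StepSeq d k} gcTerm g λ k (pos e) = (2d)^k λ^{-(k+1)} · E[e^{-g Qcfg k}]`;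
* **`susceptibility_eq_tsum_lintegral`** —
  `χ(g,ν) = Σ_k (2d)^k λ^{-(k+1)} E_λ[e^{-g Qcfg k}]`, `λ = 2d + ν > 0`.

All folklore, fully proved. [cite: BauerschmidtBrydgesSlade2015LogCorr, §1.1 and Appendix A]
(the objects), the normalisation being bookkeeping.
-/

noncomputable section

open MeasureTheory ProbabilityTheory Set Filter Literature.Probability.LatticeModels
open scoped ENNReal

namespace Literature.Barriers.CriticalPhenomena.CTWSAW

variable {d : ℕ} {lam : ℝ}

/-! ### The self-intersection functional of the first `k+1` sites -/

/-- `Qcfg k ω = Σ_{i,j ≤ k} σᵢ σⱼ 𝟙{Sᵢ = Sⱼ}` for the site process: positions `S (dirs ω)`,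
sojourns `soj ω`. [cite: BauerschmidtBrydgesSlade2015LogCorr, §1.1 (intersection local time)] -/
def Qcfg (k : ℕ) (ω : Config d) : ℝ :=
  freeSelfInt k (SRW.S (dirs ω)) (fun i : Fin (k + 1) => soj ω i)

/-- `Qcfg` unfolded. [folklore] -/
theorem Qcfg_eq (k : ℕ) (ω : Config d) : Qcfg k ω =
    ∑ i : Fin (k + 1), ∑ j : Fin (k + 1),
      if SRW.S (dirs ω) i = SRW.S (dirs ω) j then soj ω i * soj ω j else 0 := rfl

/-- The self-intersection events of the direction process are measurable. [folklore] -/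
theorem measurableSet_S_eq (i j : ℕ) : MeasurableSet {ω : Config d | SRW.S (dirs ω) i = SRW.S (dirs ω) j} :=
  measurable_dirs (SRW.measurableSet_inter i j)

/-- `Qcfg k` is measurable. [folklore] -/
@[fun_prop]
theorem measurable_Qcfg (k : ℕ) : Measurable (Qcfg (d := d) k) := by
  unfold Qcfg freeSelfInt
  refine Finset.measurable_sum _ fun i _ => Finset.measurable_sum _ fun j _ => ?_
  exact Measurable.ite (measurableSet_S_eq i j) ((measurable_soj i).mul (measurable_soj j)) measurable_const

/-- `Qcfg k` depends only on the sites `0, …, k`. [folklore] -/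
theorem dependsOn_Qcfg (k : ℕ) : DependsOn (Qcfg (d := d) k) (Finset.range (k + 1) : Set ℕ) := by
  intro ω ω' h
  unfold Qcfg freeSelfInt
  have hS : ∀ i : Fin (k + 1), SRW.S (dirs ω) i = SRW.S (dirs ω') i := by
    intro i
    unfold SRW.S SRW.incr
    refine Finset.sum_congr rfl fun l hl => ?_
    rw [dirs_apply, dirs_apply, h l (by
      simp only [Finset.coe_range, Set.mem_Iio]
      exact (Finset.mem_range.1 hl).trans i.isLt)]
  have hσ : ∀ i : Fin (k + 1), soj ω i = soj ω' i := by
    intro i; unfold soj; rw [h i (by simp only [Finset.coe_range, Set.mem_Iio]; exact i.isLt)]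
  refine Finset.sum_congr rfl fun i _ => Finset.sum_congr rfl fun j _ => ?_
  simp only [hS, hσ]

/-- `Qcfg k ≥ 0` when the sojourns are nonnegative. [folklore] -/
theorem Qcfg_nonneg {k : ℕ} {ω : Config d} (hω : ∀ i, 0 ≤ soj ω i) : 0 ≤ Qcfg k ω := by
  unfold Qcfg freeSelfInt
  refine Finset.sum_nonneg fun i _ => Finset.sum_nonneg fun j _ => ?_
  split_ifs
  · exact mul_nonneg (hω i) (hω j)
  · exact le_rfl

/-! ### Integrating against a product of exponential laws -/

/-- Membership of `Fin.cons x b` in the open orthant. [folklore] -/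
theorem cons_mem_pi_Ioi_iff {m : ℕ} (x : ℝ) (b : Fin m → ℝ) :
    (Fin.cons x b : Fin (m + 1) → ℝ) ∈ Set.pi univ (fun _ => Ioi (0 : ℝ)) ↔
      x ∈ Ioi (0 : ℝ) ∧ b ∈ Set.pi univ (fun _ => Ioi (0 : ℝ)) := by
  simp only [Set.mem_pi, Set.mem_univ, forall_true_left, Fin.forall_fin_succ, Fin.cons_zero, Fin.cons_succ]

/-- **Integrating against `Exp(λ)^{⊗ m}`**: for measurable `G ≥ 0` and `λ ≥ 0`,
`∫ G d(Exp(λ)^{⊗m}) = ∫_{(0,∞)^m} G(σ) λ^m e^{-λ Σ σ} dσ`. [folklore] -/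
theorem lintegral_pi_sojLaw [hl : Fact (0 < lam)] : ∀ (m : ℕ) {G : (Fin m → ℝ) → ℝ≥0∞}, Measurable G →
    ∫⁻ b, G b ∂(Measure.pi fun _ : Fin m => sojLaw lam) =
      ∫⁻ b in Set.pi univ (fun _ => Ioi (0 : ℝ)), G b * ENNReal.ofReal (lam ^ m * Real.exp (-lam * ∑ i, b i))
  | 0, G, hG => by
      have hpi : (Set.pi univ fun _ : Fin 0 => Ioi (0 : ℝ)) = univ := by ext b; simp
      rw [hpi, Measure.restrict_univ, volume_pi, Measure.pi_of_empty, Measure.pi_of_empty,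
        lintegral_dirac, lintegral_dirac]
      simp
  | m + 1, G, hG => by
      set e := MeasurableEquiv.piFinSuccAbove (fun _ : Fin (m + 1) => ℝ) 0 with he
      have hsymm : ∀ p : ℝ × (Fin m → ℝ), e.symm p = Fin.cons p.1 p.2 := fun p => Fin.insertNth_zero' p.1 p.2
      have hcons_meas : ∀ x : ℝ, Measurable fun b : Fin m → ℝ => (Fin.cons x b : Fin (m + 1) → ℝ) := by
        intro x
        have : (fun b : Fin m → ℝ => (Fin.cons x b : Fin (m + 1) → ℝ)) = fun b => e.symm (x, b) := by
          funext b; rw [hsymm]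
        rw [this]; exact e.symm.measurable.comp measurable_prodMk_left
      -- LHS: peel the first coordinate and use the induction hypothesis
      have hmpL : MeasurePreserving e.symm ((sojLaw lam).prod (Measure.pi fun _ : Fin m => sojLaw lam))
          (Measure.pi fun _ : Fin (m + 1) => sojLaw lam) :=
        (measurePreserving_piFinSuccAbove (fun _ : Fin (m + 1) => sojLaw lam) 0).symm
      have hGe : Measurable fun p : ℝ × (Fin m → ℝ) => G (e.symm p) := hG.comp e.symm.measurable
      rw [← hmpL.lintegral_comp_emb e.symm.measurableEmbedding, lintegral_prod _ hGe.aemeasurable]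
      simp only [hsymm]
      have hIH : ∀ x : ℝ, ∫⁻ b, G (Fin.cons x b) ∂(Measure.pi fun _ : Fin m => sojLaw lam) =
          ∫⁻ b in Set.pi univ (fun _ => Ioi (0 : ℝ)),
            G (Fin.cons x b) * ENNReal.ofReal (lam ^ m * Real.exp (-lam * ∑ i, b i)) :=
        fun x => lintegral_pi_sojLaw m (hG.comp (hcons_meas x))
      simp_rw [hIH]
      -- the inner set integral as an integral of an indicator, measurable in `x`
      set K : ℝ × (Fin m → ℝ) → ℝ≥0∞ := fun p =>
        (Set.pi univ (fun _ => Ioi (0 : ℝ))).indicator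
          (fun b => G (Fin.cons p.1 b) * ENNReal.ofReal (lam ^ m * Real.exp (-lam * ∑ i, b i))) p.2 with hK
      have hpim : MeasurableSet (Set.pi univ fun _ : Fin m => Ioi (0 : ℝ)) :=
        MeasurableSet.univ_pi fun _ => measurableSet_Ioi
      have hKm : Measurable K := by
        have hGc : Measurable fun p : ℝ × (Fin m → ℝ) => G (Fin.cons p.1 p.2) := by
          have : (fun p : ℝ × (Fin m → ℝ) => G (Fin.cons p.1 p.2)) = fun p => G (e.symm p) := by
            funext p; rw [hsymm]
          rw [this]; exact hGe
        have h1 : Measurable fun p : ℝ × (Fin m → ℝ) =>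
            G (Fin.cons p.1 p.2) * ENNReal.ofReal (lam ^ m * Real.exp (-lam * ∑ i, p.2 i)) :=
          hGc.mul (by fun_prop)
        have hK' : K = (Prod.snd ⁻¹' (Set.pi univ fun _ : Fin m => Ioi (0 : ℝ))).indicator
            (fun p : ℝ × (Fin m → ℝ) => G (Fin.cons p.1 p.2) *
              ENNReal.ofReal (lam ^ m * Real.exp (-lam * ∑ i, p.2 i))) := by
          funext p
          by_cases hp : p.2 ∈ Set.pi univ fun _ : Fin m => Ioi (0 : ℝ)
          · simp only [hK]
            rw [indicator_of_mem hp, indicator_of_mem (Set.mem_preimage.2 hp)]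
          · simp only [hK]
            rw [indicator_of_notMem hp, indicator_of_notMem (fun h => hp (Set.mem_preimage.1 h))]
        rw [hK']
        exact h1.indicator (hpim.preimage measurable_snd)
      have hinner : ∀ x : ℝ, ∫⁻ b in Set.pi univ (fun _ => Ioi (0 : ℝ)),
          G (Fin.cons x b) * ENNReal.ofReal (lam ^ m * Real.exp (-lam * ∑ i, b i)) = ∫⁻ b, K (x, b) := by
        intro x; rw [← lintegral_indicator hpim]
      simp_rw [hinner]
      rw [lintegral_sojLaw lam (hKm.lintegral_prod_right')]
      -- RHS: peel the first coordinate of Lebesgue measure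
      have hpim1 : MeasurableSet (Set.pi univ fun _ : Fin (m + 1) => Ioi (0 : ℝ)) :=
        MeasurableSet.univ_pi fun _ => measurableSet_Ioi
      set H : (Fin (m + 1) → ℝ) → ℝ≥0∞ := (Set.pi univ (fun _ => Ioi (0 : ℝ))).indicator
        fun b => G b * ENNReal.ofReal (lam ^ (m + 1) * Real.exp (-lam * ∑ i, b i)) with hH
      have hHm : Measurable H := (hG.mul (by fun_prop)).indicator hpim1
      have hmpR : MeasurePreserving e.symm ((volume : Measure ℝ).prod volume) volume :=
        (volume_preserving_piFinSuccAbove (fun _ : Fin (m + 1) => ℝ) 0).symm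
      rw [← lintegral_indicator hpim1, ← hH, ← hmpR.lintegral_comp_emb e.symm.measurableEmbedding,
        lintegral_prod (fun a => H (e.symm a)) (hHm.comp e.symm.measurable).aemeasurable,
        ← lintegral_indicator measurableSet_Ioi]
      refine lintegral_congr fun x => ?_
      simp only [hsymm]
      by_cases hx : x ∈ Ioi (0 : ℝ)
      · rw [indicator_of_mem hx]
        rw [← lintegral_const_mul (sojDensity lam x) (f := fun y => K (x, y)) (hKm.comp measurable_prodMk_left)]
        refine lintegral_congr fun b => ?_
        simp only [hK, hH]
        by_cases hb : b ∈ Set.pi univ fun _ : Fin m => Ioi (0 : ℝ)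
        · rw [indicator_of_mem hb, indicator_of_mem ((cons_mem_pi_Ioi_iff x b).2 ⟨hx, hb⟩), sojDensity,
            mul_left_comm, ← ENNReal.ofReal_mul (mul_nonneg hl.out.le (Real.exp_pos _).le)]
          congr 2
          rw [Fin.sum_univ_succ]
          simp only [Fin.cons_zero, Fin.cons_succ]
          rw [pow_succ, mul_add, Real.exp_add]
          ring
        · rw [indicator_of_notMem hb, indicator_of_notMem (fun h => hb ((cons_mem_pi_Ioi_iff x b).1 h).2),
            mul_zero]
      · rw [indicator_of_notMem hx]
        symm
        refine (lintegral_eq_zero_iff (hHm.comp (hcons_meas x))).2 (Eventually.of_forall fun b => ?_)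
        simp only [hH, Pi.zero_apply]
        exact indicator_of_notMem (fun h => hx ((cons_mem_pi_Ioi_iff x b).1 h).1) _

/-! ### The expectation of `e^{-g Qcfg k}` -/

/-- Positions of a step sequence do not depend on the steps after the index. [folklore] -/
theorem pos_snoc {k : ℕ} (e : SRW.StepSeq d k) (v : SRW.Dir d) {i : ℕ} (hi : i ≤ k) :
    SRW.pos (Fin.snoc e v : SRW.StepSeq d (k + 1)) i = SRW.pos e i := by
  rw [SRW.pos_eq_sum_range _ (hi.trans (Nat.le_succ k)), SRW.pos_eq_sum_range _ hi]
  refine Finset.sum_congr rfl fun l hl => ?_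
  have hl' : l < k := lt_of_lt_of_le (Finset.mem_range.1 hl) hi
  rw [dif_pos (hl'.trans (Nat.lt_succ_self k)), dif_pos hl']
  congr 1
  show (Fin.snoc e v : SRW.StepSeq d (k + 1)) (Fin.castSucc ⟨l, hl'⟩) = e ⟨l, hl'⟩
  rw [Fin.snoc_castSucc]

/-- The integrand of the bridge on the first `k+1` sites. [folklore] -/
def bridgeF (g : ℝ) (k : ℕ) (z : Fin (k + 1) → SiteVal d) : ℝ≥0∞ :=
  ENNReal.ofReal (Real.exp (-g * freeSelfInt k (SRW.pos (fun l : Fin (k + 1) => (z l).1))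
    (fun i : Fin (k + 1) => (z i).2)))

/-- Measurability of the bridge integrand. [folklore] -/
theorem measurable_bridgeF (g : ℝ) (k : ℕ) : Measurable (bridgeF (d := d) g k) := by
  unfold bridgeF freeSelfInt
  refine ENNReal.measurable_ofReal.comp (Real.measurable_exp.comp (measurable_const.mul ?_))
  refine Finset.measurable_sum _ fun i _ => Finset.measurable_sum _ fun j _ => ?_
  refine Measurable.ite ?_ ((measurable_pi_apply i).snd.mul (measurable_pi_apply j).snd) measurable_const
  -- the event is the preimage of a set of direction tuples under a measurable map into a countable space
  have hdm : Measurable fun (z : Fin (k + 1) → SiteVal d) (l : Fin (k + 1)) => (z l).1 :=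
    measurable_pi_lambda _ fun l => (measurable_pi_apply l).fst
  exact hdm (Set.Countable.measurableSet (Set.to_countable _) :
    MeasurableSet {e : SRW.StepSeq d (k + 1) | SRW.pos e i = SRW.pos e j})

/-- Reading the bridge integrand on a configuration gives `e^{-g Qcfg k}`. [folklore] -/
theorem bridgeF_restrict (g : ℝ) (k : ℕ) (ω : Config d) :
    bridgeF g k (fun i : Fin (k + 1) => ω i) = ENNReal.ofReal (Real.exp (-g * Qcfg k ω)) := by
  unfold bridgeF Qcfg
  dsimp only
  have hv := freeSelfInt_congr (m := k) (v := SRW.pos fun l : Fin (k + 1) => (ω l).1) (v' := SRW.S (dirs ω))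
    (fun i hi => SRW.pos_restrict (dirs ω) (k + 1) (hi.trans (Nat.le_succ k)))
  rw [hv]
  rfl

/-- **The expectation of `e^{-g Qcfg k}` over the site process**, `λ > 0`, `d ≥ 1`:
`E[e^{-g Qcfg k}] = λ^{k+1} (2d)^{-k} Σ_{e : StepSeq d k} gcTerm g λ k (pos e)`. [folklore] -/
theorem lintegral_exp_Qcfg_eq [NeZero d] [hl : Fact (0 < lam)] (g : ℝ) (k : ℕ) :
    ∫⁻ ω, ENNReal.ofReal (Real.exp (-g * Qcfg k ω)) ∂(configLaw d lam) =
      ENNReal.ofReal (lam ^ (k + 1) / (2 * d : ℝ) ^ k) *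
        ∑ e : SRW.StepSeq d k, gcTerm g lam k (SRW.pos e) := by
  classical
  have hlam := hl.out
  have hd : (0 : ℝ) < d := by exact_mod_cast Nat.pos_of_ne_zero (NeZero.ne d)
  -- Step 1: project to the first k+1 sites
  have h1 : ∫⁻ ω, ENNReal.ofReal (Real.exp (-g * Qcfg k ω)) ∂(configLaw d lam) =
      ∫⁻ z, bridgeF g k z ∂(Measure.pi fun _ : Fin (k + 1) => siteLaw d lam) := by
    rw [← lintegral_comp_restrict (k + 1) (measurable_bridgeF g k)]
    simp_rw [bridgeF_restrict]
  -- Step 2: split directions and sojourns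
  set ψ := MeasurableEquiv.arrowProdEquivProdArrow (SRW.Dir d) ℝ (Fin (k + 1)) with hψ
  have hmp : MeasurePreserving ψ (Measure.pi fun _ : Fin (k + 1) => siteLaw d lam)
      ((Measure.pi fun _ : Fin (k + 1) => SRW.stepLaw d).prod (Measure.pi fun _ : Fin (k + 1) => sojLaw lam)) :=
    measurePreserving_arrowProdEquivProdArrow (SRW.Dir d) ℝ (Fin (k + 1)) (fun _ => SRW.stepLaw d)
      (fun _ => sojLaw lam)
  set Gf : (Fin (k + 1) → SRW.Dir d) → (Fin (k + 1) → ℝ) → ℝ≥0∞ := fun a b =>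
    ENNReal.ofReal (Real.exp (-g * freeSelfInt k (SRW.pos a) b)) with hGf
  have hGfm : Measurable fun p : (Fin (k + 1) → SRW.Dir d) × (Fin (k + 1) → ℝ) => Gf p.1 p.2 := by
    have : (fun p : (Fin (k + 1) → SRW.Dir d) × (Fin (k + 1) → ℝ) => Gf p.1 p.2) = bridgeF g k ∘ ψ.symm := by
      funext p; rfl
    rw [this]; exact (measurable_bridgeF g k).comp ψ.symm.measurable
  have h2 : ∫⁻ z, bridgeF g k z ∂(Measure.pi fun _ : Fin (k + 1) => siteLaw d lam) =
      ∫⁻ a, ∫⁻ b, Gf a b ∂(Measure.pi fun _ : Fin (k + 1) => sojLaw lam)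
        ∂(Measure.pi fun _ : Fin (k + 1) => SRW.stepLaw d) := by
    rw [← lintegral_prod (fun p => Gf p.1 p.2) hGfm.aemeasurable, ← hmp.lintegral_comp hGfm]
    rfl
  -- Step 3: the sojourn integral is λ^{k+1} gcTerm
  have h3 : ∀ a : Fin (k + 1) → SRW.Dir d, ∫⁻ b, Gf a b ∂(Measure.pi fun _ : Fin (k + 1) => sojLaw lam) =
      ENNReal.ofReal (lam ^ (k + 1)) * gcTerm g lam k (SRW.pos a) := by
    intro a
    have hGa : Measurable (Gf a) := by
      simp only [hGf]
      exact ENNReal.measurable_ofReal.comp (Real.measurable_exp.comp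
        (measurable_const.mul (continuous_freeSelfInt k _).measurable))
    rw [lintegral_pi_sojLaw (k + 1) hGa, gcTerm, ← lintegral_const_mul' _ _ ENNReal.ofReal_ne_top]
    refine setLIntegral_congr_fun (MeasurableSet.univ_pi fun _ => measurableSet_Ioi) fun b _ => ?_
    simp only [hGf, gcIntegrand]
    rw [← ENNReal.ofReal_mul (Real.exp_pos _).le, ← ENNReal.ofReal_mul (by positivity)]
    congr 1
    rw [sub_eq_add_neg, Real.exp_add, ← neg_mul]
    ring
  simp_rw [h1, h2, h3]
  -- Step 4: the direction integral is a normalised finite sum; the last direction is free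
  rw [SRW.pi_stepLaw_eq, lintegral_smul_measure, lintegral_count, tsum_fintype, smul_eq_mul,
    ← Finset.mul_sum, ← (Fin.snocEquiv fun _ : Fin (k + 1) => SRW.Dir d).sum_comp, Fintype.sum_prod_type]
  have hsnoc : ∀ (v : SRW.Dir d) (e : SRW.StepSeq d k),
      gcTerm g lam k (SRW.pos ((Fin.snocEquiv fun _ : Fin (k + 1) => SRW.Dir d) (v, e))) =
        gcTerm g lam k (SRW.pos e) :=
    fun v e => gcTerm_congr _ _ fun i hi => pos_snoc e v hi
  simp_rw [hsnoc]
  rw [Finset.sum_const, Finset.card_univ, SRW.card_dir, nsmul_eq_mul]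
  -- arithmetic of the constants
  have h2d : ((2 * d : ℕ) : ℝ≥0∞) = ENNReal.ofReal (2 * d : ℝ) := by
    rw [← ENNReal.ofReal_natCast]; push_cast; ring_nf
  rw [h2d, ← ENNReal.ofReal_pow (by positivity), ← ENNReal.ofReal_inv_of_pos (by positivity), ← mul_assoc,
    ← mul_assoc, ← ENNReal.ofReal_mul (by positivity), ← ENNReal.ofReal_mul (by positivity)]
  congr 2
  rw [pow_succ]
  field_simp

/-- **The `k`-th grand-canonical term as an expectation**:
`Σ_{e : StepSeq d k} gcTerm g λ k (pos e) = (2d)^k λ^{-(k+1)} E_λ[e^{-g Qcfg k}]`. [folklore] -/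
theorem sum_gcTerm_eq [NeZero d] [hl : Fact (0 < lam)] (g : ℝ) (k : ℕ) :
    ∑ e : SRW.StepSeq d k, gcTerm g lam k (SRW.pos e) =
      ENNReal.ofReal ((2 * d : ℝ) ^ k / lam ^ (k + 1)) *
        ∫⁻ ω, ENNReal.ofReal (Real.exp (-g * Qcfg k ω)) ∂(configLaw d lam) := by
  have hlam := hl.out
  have hd : (0 : ℝ) < d := by exact_mod_cast Nat.pos_of_ne_zero (NeZero.ne d)
  have hc : (0 : ℝ) < lam ^ (k + 1) / (2 * d : ℝ) ^ k := by positivity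
  rw [lintegral_exp_Qcfg_eq g k, ← mul_assoc, ← ENNReal.ofReal_mul (by positivity)]
  have : (2 * d : ℝ) ^ k / lam ^ (k + 1) * (lam ^ (k + 1) / (2 * d : ℝ) ^ k) = 1 := by
    field_simp
  rw [this, ENNReal.ofReal_one, one_mul]

/-- **The susceptibility as a series of expectations over the site process**: for `λ = 2d + ν > 0`,
`χ(g,ν) = Σ_k (2d)^k λ^{-(k+1)} E_λ[e^{-g Qcfg k}]`. [cite: BauerschmidtBrydgesSlade2015LogCorr, §1.1 (χ) and Appendix A] -/
theorem susceptibility_eq_tsum_lintegral [NeZero d] (g ν : ℝ) [hl : Fact (0 < 2 * (d : ℝ) + ν)] :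
    susceptibility d g ν = ∑' k : ℕ, ENNReal.ofReal ((2 * d : ℝ) ^ k / (2 * d + ν) ^ (k + 1)) *
      ∫⁻ ω, ENNReal.ofReal (Real.exp (-g * Qcfg k ω)) ∂(configLaw d (2 * d + ν)) := by
  rw [susceptibility_eq_tsum_stepSeq]
  exact tsum_congr fun k => sum_gcTerm_eq (lam := 2 * d + ν) g k

/-- The same with the killing rate as the parameter: for `λ > 0`,
`χ(g, λ - 2d) = Σ_k (2d)^k λ^{-(k+1)} E_λ[e^{-g Qcfg k}]`. [cite: BauerschmidtBrydgesSlade2015LogCorr, §1.1 (χ) and Appendix A] -/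
theorem susceptibility_eq_tsum_lintegral' [NeZero d] [Fact (0 < lam)] (g : ℝ) :
    susceptibility d g (lam - 2 * d) = ∑' k : ℕ, ENNReal.ofReal ((2 * d : ℝ) ^ k / lam ^ (k + 1)) *
      ∫⁻ ω, ENNReal.ofReal (Real.exp (-g * Qcfg k ω)) ∂(configLaw d lam) := by
  rw [susceptibility_eq_tsum_stepSeq, show (2 * d : ℝ) + (lam - 2 * d) = lam by ring]
  exact tsum_congr fun k => sum_gcTerm_eq g k

end Literature.Barriers.CriticalPhenomena.CTWSAW
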